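import Literature.NumberTheory.EllipticCurves.JZeroTwoPowerTorsionGaloisLine
import Literature.NumberTheory.EllipticCurves.SelmerTorsionCMOperatorJZero
import HarnessLib

/-!
# A Galois element fixing `B[2^M]` and moving `A[2^M]` invertibly, from one doing so at level `2`

Topic `NumberTheory/EllipticCurves`; namespace `Literature.NumberTheory.EllipticCurves.JZero`. THEOREMS ONLY: **no
definition and no named fact** (D-0026). Sequel of `JZeroTwoPowerTorsionGaloisLine` ((α) `σ = a + b·fn`, (β), (δ)).
* `apply_apply_add_eq_zero_of_formula`, `torsion_hrel_of_formula`: ANY isogeny `φ` of `y² = x³ + B` with the pinned action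
  `(x, y) ↦ (ζ² x, ζ³ y)` (`ζ ∈ K` a primitive cube root of unity) has `φ² + φ + 1 = 0` on `E(K̄)` and on `E[n]` (`φ = [ζ]`,
  Silverman AEC III.10.1): the `hrel` binder of the Galois-line file comes from a formula clause and `hcoe` alone.
* ★ `moving_lift`: if `z ∈ Γ_K` fixes `B[2]` pointwise and `P ↦ z • P - P` is onto `A[2]`, then `z' := z ^ 2^(M-1)` fixes
  `B[2^M]` pointwise ((δ)) and `P ↦ z' • P - P` is BIJECTIVE on `A[2^M]`: `z - 1` is injective on the finite `A[2]`, so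
  `z` fixes no non-zero `2`-torsion point of `A[2^M]`; by (α) `z ≡ fn` or `fn²` on the `2`-torsion — an action of ORDER
  `3` (`z² + z + 1 = 0` there) — and `3 ∤ 2^(M-1)` is exactly where this bites: no `2`-power of `z` fixes `A[2]`, so `z'`
  moves a `2`-torsion point and (β) applies.  The level-`2^M` form of the element "fixing `K(B[2])`, acting as `[ζ]` on
  `A[2]`" of the Čebotarev step for a pair of `j = 0` curves. [Rubin1999] K. Rubin, *Elliptic curves with complex
  multiplication and the conjecture of BSD*, LNM 1716 (1999), Lemma 6.1, 6.2 (i); [GrossLMS1991] B. H. Gross, *Kolyvagin's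
  work on modular elliptic curves* (1991), §9; [SilvermanAEC2009] J. H. Silverman, *AEC*, 2nd ed., Thm. III.10.1, Cor. III.10.2.
-/

noncomputable section

open scoped Classical

universe u

namespace Literature.NumberTheory.EllipticCurves.JZero

open _root_.WeierstrassCurve Field CMTorsionLine

variable {K : Type u} [Field K] [CharZero K]

section Formula

variable {V : WeierstrassCurve K} [V.IsElliptic] {B ζ : K} (hV : V = ⟨0, 0, 0, 0, B⟩) (hζ : IsPrimitiveRoot ζ 3)
  (φ : Isogeny V V)
  (hφ : ∀ (x y : AlgebraicClosure K) (h : (V.baseChange (AlgebraicClosure K)).toAffine.Nonsingular x y),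
    ∃ h', φ (Affine.Point.some x y h) =
      Affine.Point.some (algebraMap K (AlgebraicClosure K) ζ ^ 2 * x) (algebraMap K (AlgebraicClosure K) ζ ^ 3 * y) h')
include hV hζ hφ

/-- **`φ² + φ + 1 = 0` for any isogeny of `y² = x³ + B` acting by `(x, y) ↦ (ζ² x, ζ³ y)`**: it agrees pointwise with
the `[ζ]` of `JZero.exists_cm_isogeny_of_eq` (`ζ³ = 1`). [cite: SilvermanAEC2009, Thm. III.10.1 and Cor. III.10.2] -/
theorem apply_apply_add_eq_zero_of_formula (P : geomPoints V) : φ (φ P) + φ P + P = 0 := by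
  obtain ⟨ψ, hψ, hψrel⟩ := JZero.exists_cm_isogeny_of_eq hV hζ
  have hζ3 : algebraMap K (AlgebraicClosure K) ζ ^ 3 = 1 := by rw [← map_pow, hζ.pow_eq_one, map_one]
  have heq : ∀ P, φ P = ψ P := by
    intro P
    cases P with
    | zero => change φ 0 = ψ 0; rw [map_zero, map_zero]
    | @some x y h =>
      obtain ⟨h', e⟩ := hφ x y h
      obtain ⟨h'', e'⟩ := hψ x y h
      rw [e, e']; congr 1; rw [hζ3, one_mul]
  rw [heq P, heq (ψ P)]
  exact hψrel P

/-- **The torsion-level relation `fn² + fn + 1 = 0`** for the restriction `fn` of such a `φ` to `E[n]` (`hcoe`): the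
`hrel` binder of `JZeroTwoPowerTorsionGaloisLine`. [cite: SilvermanAEC2009, Thm. III.10.1 and Cor. III.10.2] -/
theorem torsion_hrel_of_formula (n : ℤ) (fn : geomTorsion V n →+ geomTorsion V n)
    (hcoe : ∀ Q : geomTorsion V n, ((fn Q : geomTorsion V n) : geomPoints V) = φ Q) (Q : geomTorsion V n) :
    fn (fn Q) + fn Q + Q = 0 := by
  apply Subtype.ext
  change ((fn (fn Q) : geomTorsion V n) : geomPoints V) + ((fn Q : geomTorsion V n) : geomPoints V) + Q = 0
  rw [hcoe, hcoe]
  exact apply_apply_add_eq_zero_of_formula hV hζ φ hφ Q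

end Formula

section Moving

variable (A B : WeierstrassCurve K) [A.IsElliptic] (n : ℕ) [NeZero n] {M : ℕ}
  (fn : geomTorsion A (n : ℤ) →+ geomTorsion A (n : ℤ)) (hn : n = 2 ^ M) (hM : 1 ≤ M)
  (hrel : ∀ Q, fn (fn Q) + fn Q + Q = 0)
  (hfn : ∀ (g : absoluteGaloisGroup K) (Q : geomTorsion A (n : ℤ)), fn (g • Q) = g • fn Q)
include hn hM hrel hfn

/-- ★ **Lifting the level-`2` moving element to level `2^M`.** If `z ∈ Γ_K` fixes `B[2]` pointwise and `P ↦ z • P - P`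
is onto `A[2]` (the output of the level-`2` Kummer-independence step), then `z ^ 2^(M-1)` fixes `B[2^M]` pointwise and
`P ↦ z ^ 2^(M-1) • P - P` is bijective on `A[2^M]`.  D440: `hzA` is genuine (`z = 1` satisfies `hzB` and fails the
conclusion), `hzB` is genuine for the first conjunct; the exponent must be a `2`-power for (δ) and is harmless on `A`
exactly because `z` acts on `A[2]` with order `3` and `3 ∤ 2^(M-1)`.
[cite: Rubin1999, Lemma 6.1, Lemma 6.2 (i)] [cite: GrossLMS1991, §9 (Prop. 9.1)] -/
theorem moving_lift (z : absoluteGaloisGroup K) (hzB : z ∈ torsionFixing B ((2 : ℕ) : ℤ))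
    (hzA : ∀ Q : geomTorsion A ((2 : ℕ) : ℤ), ∃ P, z • P - P = Q) :
    z ^ 2 ^ (M - 1) ∈ torsionFixing B (n : ℤ) ∧ Function.Bijective fun P : geomTorsion A (n : ℤ) ↦ z ^ 2 ^ (M - 1) • P - P := by
  refine ⟨pow_two_pow_mem_torsionFixing_of_forall_two_torsion B n hn hM z
    fun Q hQ ↦ smul_eq_self_of_mem_torsionFixing_two B n z hzB Q hQ, ?_⟩
  have hsm : ∀ (g : absoluteGaloisGroup K) (c : ℤ) (P : geomTorsion A (n : ℤ)), g • (c • P) = c • (g • P) :=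
    fun g c P ↦ map_zsmul (DistribSMul.toAddMonoidHom _ g) c P
  have h2z : ∀ (g : absoluteGaloisGroup K) (Q : geomTorsion A (n : ℤ)), (2 : ℤ) • Q = 0 → (2 : ℤ) • (g • Q) = 0 :=
    fun g Q hQ ↦ by rw [← hsm, hQ, smul_zero]
  have h2fn : ∀ Q : geomTorsion A (n : ℤ), (2 : ℤ) • Q = 0 → (2 : ℤ) • fn Q = 0 := fun Q hQ ↦ by rw [← map_zsmul, hQ, map_zero]
  have hev : ∀ (c : ℤ) (S : geomTorsion A (n : ℤ)), (2 : ℤ) • S = 0 → (2 * c) • S = 0 := fun c S hS ↦ by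
    rw [mul_comm, mul_smul, hS, smul_zero]
  have hodd : ∀ (c : ℤ) (S : geomTorsion A (n : ℤ)), (2 : ℤ) • S = 0 → (2 * c + 1) • S = S := fun c S hS ↦ by
    rw [add_smul, hev c S hS, zero_add, one_smul]
  -- `z - 1` is onto, hence injective, on the finite `A[2]`: `z` fixes no non-zero `2`-torsion point of `A[2^M]`
  have hfix2 : ∀ Q : geomTorsion A (n : ℤ), (2 : ℤ) • Q = 0 → z • Q = Q → Q = 0 := by
    intro Q hQ hzQ
    haveI : Finite (geomTorsion A ((2 : ℕ) : ℤ)) := finite_torsionPoints_holds A (AlgebraicClosure K) (by norm_num)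
    have hinj : Function.Injective fun P : geomTorsion A ((2 : ℕ) : ℤ) ↦ z • P - P := Finite.injective_iff_surjective.mpr hzA
    have hmem : (Q : geomPoints A) ∈ geomTorsion A ((2 : ℕ) : ℤ) := by
      rw [mem_geomTorsion_iff, Nat.cast_ofNat, ← AddSubgroupClass.coe_zsmul, hQ, ZeroMemClass.coe_zero]
    have hfixQ₂ : z • (⟨Q, hmem⟩ : geomTorsion A ((2 : ℕ) : ℤ)) = ⟨Q, hmem⟩ := by
      apply Subtype.ext
      have h := congrArg Subtype.val hzQ
      rwa [AddSubgroup.torsionBy.coe_smul] at h ⊢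
    have h0 : (⟨Q, hmem⟩ : geomTorsion A ((2 : ℕ) : ℤ)) = 0 := hinj (by
      change z • (⟨Q, hmem⟩ : geomTorsion A ((2 : ℕ) : ℤ)) - ⟨Q, hmem⟩ = z • 0 - 0
      rw [hfixQ₂, sub_self, smul_zero, sub_self])
    exact Subtype.ext (show (Q : geomPoints A) = 0 from congrArg Subtype.val h0)
  -- a non-zero `2`-torsion point `R`, moved by `z`
  obtain ⟨P₀, hP₀⟩ := exists_two_pow_pred_zsmul_ne_zero A n hn hM
  set R := ((2 : ℤ) ^ (M - 1)) • P₀ with hRdef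
  have hR2 : (2 : ℤ) • R = 0 := by rw [hRdef, smul_smul, ← pow_succ', Nat.sub_add_cancel hM]; exact two_pow_zsmul_geomTorsion A n hn P₀
  have hzR : z • R ≠ R := fun h ↦ hP₀ (hfix2 R hR2 h)
  -- (α): `z = a + b·fn`; on the `2`-torsion `(a, b) ≡ (0, 1)` or `(1, 1)`, so `z² + z + 1 = 0` there
  obtain ⟨a, b, hab⟩ := smul_eq_zsmul_add_zsmul_fn A n fn hn hM hrel hfn z
  have hzz : ∀ Q : geomTorsion A (n : ℤ), (2 : ℤ) • Q = 0 → z • (z • Q) + z • Q + Q = 0 := by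
    intro Q hQ
    have hQ' := h2fn Q hQ
    obtain ⟨c, hc⟩ := Int.even_or_odd' a
    obtain ⟨d, hd⟩ := Int.even_or_odd' b
    rcases hc with rfl | rfl <;> rcases hd with rfl | rfl
    · exfalso; apply hP₀ -- `z` would kill the `2`-torsion
      exact (smul_eq_zero_iff_eq z).mp (by rw [hab, hev c R hR2, hev d (fn R) (h2fn R hR2), add_zero])
    · have hS : ∀ S, (2 : ℤ) • S = 0 → z • S = fn S := fun S hS ↦ by -- `z = fn`
        rw [hab, hev c S hS, hodd d (fn S) (h2fn S hS), zero_add]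
      rw [hS Q hQ, hS (fn Q) hQ']; exact hrel Q
    · exfalso; apply hzR -- `z` would fix the `2`-torsion
      rw [hab, hodd c R hR2, hev d (fn R) (h2fn R hR2), add_zero]
    · have hS : ∀ S, (2 : ℤ) • S = 0 → z • S = S + fn S := fun S hS ↦ by -- `z = 1 + fn = fn²`
        rw [hab, hodd c S hS, hodd d (fn S) (h2fn S hS)]
      have h2' : (2 : ℤ) • (Q + fn Q) = 0 := by rw [smul_add, hQ, hQ', add_zero]
      rw [hS Q hQ, hS (Q + fn Q) h2', map_add]
      have e : Q + fn Q + (fn Q + fn (fn Q)) + (Q + fn Q) + Q = (fn (fn Q) + fn Q + Q) + (2 : ℤ) • Q + (2 : ℤ) • fn Q := by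
        module
      rw [e, hrel Q, hQ, hQ', add_zero, add_zero]
  -- hence `z³ = 1` on the `2`-torsion, and `z ^ 2^(M-1)` acts there as `z` or `z²` (`3 ∤ 2^(M-1)`)
  have hz3 : ∀ Q : geomTorsion A (n : ℤ), (2 : ℤ) • Q = 0 → z • (z • (z • Q)) = Q := fun Q hQ ↦ by
    have e1 : z • (z • Q) + z • Q = -Q := by rw [← sub_eq_zero, sub_neg_eq_add, hzz Q hQ]
    simpa only [add_assoc, e1, add_neg_eq_zero] using hzz (z • Q) (h2z z Q hQ)
  have hz3pow : ∀ (t : ℕ) (Q : geomTorsion A (n : ℤ)), (2 : ℤ) • Q = 0 → (z ^ 3) ^ t • Q = Q := by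
    intro t
    induction t with
    | zero => intro Q _; rw [pow_zero, one_smul]
    | succ t ih => intro Q hQ; rw [pow_succ, mul_smul, pow_three, mul_smul, mul_smul, hz3 Q hQ]; exact ih Q hQ
  have hzzR : z • (z • R) ≠ R := fun h ↦ hzR (by
    have h' : z • (z • (z • R)) = z • R := congrArg (fun X ↦ z • X) h
    rw [hz3 R hR2] at h'; exact h'.symm)
  have hr : 2 ^ (M - 1) % 3 = 1 ∨ 2 ^ (M - 1) % 3 = 2 := by
    have h3 : ¬ (3 ∣ 2 ^ (M - 1)) := fun h ↦ by have := Nat.Prime.dvd_of_dvd_pow Nat.prime_three h; omega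
    set x := 2 ^ (M - 1)
    omega
  have hz'R : z ^ 2 ^ (M - 1) • R ≠ R := by
    rw [← Nat.div_add_mod (2 ^ (M - 1)) 3, pow_add, pow_mul, mul_smul, hz3pow _ _ (h2z _ R hR2)]
    rcases hr with hr | hr
    · rw [hr, pow_one]; exact hzR
    · rw [hr, sq, mul_smul]; exact hzzR
  exact bijective_smul_sub_of_two_torsion_ne A n fn hn hM hrel hfn _ hR2 hz'R

end Moving

end Literature.NumberTheory.EllipticCurves.JZero

end
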